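import Summits.BirchSwinnertonDyer.BirchSwinnertonDyer.Theorems.GenusKolyvaginAtTwoMinimalTwinBSDTwoOddCutDeepTwinClass
import Summits.BirchSwinnertonDyer.BirchSwinnertonDyer.Theorems.GenusKolyvaginAtTwoMinimalTwinBSDTwoOddManinDatum
import HarnessLib

/-!
# Route `GenusKolyvaginAtTwo`, crux U₂ `MinimalTwinBSDTwo` (stmt-BirchSwinnertonDyer-22985), LINE 23 «twin_swap» — THE ODD-`c`-FREE FRAME LEAF ON `4 ∤ N`:
# U₂ on the odd habitat cut with `4 ∤ N_W` ⟸ WALL row 1 + PRINT (+ Abbes–Ullmo + Česnavičius) + Q2 + FRAME♭⁰ (no Manin clause)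

Seat `bsd-line-gk2-p2` g33 (PROVER seat 2/3, cell `bsd-f1-sign2`, LINE 23 holder), `--supports stmt-BirchSwinnertonDyer-22985 --as helper`.
THEOREMS ONLY (no definition, no named fact, no `sorry`).  BSD is NOT proved by any of this; U₂ is NOT proved; nothing is closed.

WHAT.  The FRAME♭ leaf of the witness-free census form (p815975 `minimalTwinBSDTwo_onOddCut_of_wall_of_deepTwinClassFrameSupply_of_facts`) asks per `W`
for «a datum `Dt` with `Odd Dt.c`».  By `OddManin.exists_datum_odd_c_conductor_of_forall_hasSurjectiveModNGaloisRep_of_not_four_dvd` (p816794) such a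
datum EXISTS on the cut whenever `4 ∤ N_W`, modulo the named facts of Abbes–Ullmo (Thm. A) and Česnavičius (Thm. 1.2, `2 ∥ N`).  So on `4 ∤ N` the
leaf may be read WITHOUT the Manin clause, universally over odd data:
* §1 `bsdp_onOddCut_of_deepTwinClassFrame_of_facts` — the per-curve road of p815975 §2 (ONE frame: `K`, odd-`c` datum, depth `M₀`, budget twin model,
  `M₀ = 0 ∨` deep twin class ⟹ `BSD₂(W)`), extracted so that frame supplies of any quantifier shape can be plugged in.
* §2 `minimalTwinBSDTwo_onOddCut_notFourDvd_of_wall_of_oddFreeFrameSupply_of_facts` — **U₂ on the cut with `4 ∤ N_W` ⟸ WALL row 1 + PRINT + AU + Čes +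
  Q2 + FRAME♭⁰**, where FRAME♭⁰ is FRAME♭ with the conjunct `Odd Dt.c` DELETED and the datum quantified universally over odd data
  (`∀ Dt, Odd Dt.c → ∃ K β ι d₁ M₀ …`): the Manin constant has left the research leaf on `4 ∤ N`.
* §3 `minimalTwinBSDTwo_onOddCut_of_wall_of_splitFrameSupply_of_facts` — the whole cut: FRAME♭⁰ on `4 ∤ N_W` and FRAME♭ (as before) on `4 ∣ N_W`
  (additive reduction at `2` with `v₂(N) ≥ 2`, where the parity of the Manin constant is open in print).

HONEST FRAMING.  CONDITIONAL on the displayed hypotheses; FRAME♭⁰ is OPEN (analytic non-vanishing inside the genus budget + the Selmer-depth bit of the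
twin); nothing beyond print is claimed; BSD is NOT proved.

References: [AbbesUllmo1996] Thm. A; [Cesnavicius2018] Thm. 1.2; [GreenbergVatsal2000] §3 Rem. 3.4; [Kolyvagin1989Izv] Thm. B_l; [GrossZagier1986] V.§2 (2.2).
-/

set_option autoImplicit false
set_option linter.dupNamespace false -- `Summit.<P>.<Sub>` repeats `BirchSwinnertonDyer` (D-0017)

noncomputable section

open scoped Classical

namespace Summit.BirchSwinnertonDyer.BirchSwinnertonDyer.Theorems.GenusExact.TwinSwap.TwinAnnihilation

open Literature.NumberTheory.EllipticCurves Literature.NumberTheory.GaloisRepresentations WeierstrassCurve NumberField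
  IsDedekindDomain Field AddSubgroup Literature.NumberTheory.EllipticCurves.ModularForms
open Summit.BirchSwinnertonDyer.Rank1Residual
open Summit.BirchSwinnertonDyer.BirchSwinnertonDyer.Theses.GenusKolyvaginAtTwo (KolyvaginRelationAtTwo)

/-! ## §1 The per-curve road: one «twin Selmer as deep as y_K» frame ⟹ `BSD₂(W)` -/

/-- **`BSD₂(W)` on the odd habitat cut from ONE deep-twin-class frame** (p815975 §2, per curve): `W` non-CM of analytic rank `1` with `#Sel₂(W) = 2`,
`C(W)` odd, an odd multiplicative prime, `ρ_{W,2^n}` onto; an odd Heegner frame `K ≠ ℚ(√−3)`, an odd-`c` datum, a conductor-`1` datum with `P(1)` of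
infinite order and exact depth `M₀`, a globally minimal twin model inside the genus budget, and EITHER `M₀ = 0` OR a class of `Sel_(2^M)(W^{(d_K)}/ℚ)`
(`M ≥ M₀+1`) not killed by `2^{M₀−1}`; WALL row 1 pays `BSD₂` of the twin (non-CM, analytic rank `0` by Gross–Zagier).  Modulo Q2 + GZ + GZK +
modularity + Milne.  CONDITIONAL; closes nothing; BSD is NOT proved. [cite: Kolyvagin1989Izv, Thm. A, Thm. B_l] [cite: GrossZagier1986, V.§2 (2.2)] -/
theorem bsdp_onOddCut_of_deepTwinClassFrame_of_facts (hQ2 : KolyvaginRelationAtTwo)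
    (hGZ : ∀ (N : ℕ) [NeZero N] (W : WeierstrassCurve ℚ) (K : Type) [Field K] [NumberField K], gross_zagier N W K)
    (hGZK : rank_eq_analyticRank_of_analyticRank_le_one) (hmod : hasEntireLFunction_rat)
    (hMilneC : Milne1972.bsdQuotient_baseChange_quadratic_anyModel)
    (hS1 : ∀ (W : WeierstrassCurve ℚ) [W.IsElliptic] [W.IsGloballyMinimal], ¬ W.HasCM → W.analyticRank = 0 → BSDp W 2)
    (W : WeierstrassCurve ℚ) [W.IsElliptic] [W.IsGloballyMinimal] [NeZero (W.conductorNorm ℤ)] (hcm : ¬ W.HasCM)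
    (hr : W.analyticRank = 1) (hSel : Nat.card (W.selmerGroup 2) = 2)
    (hT : Odd W.tamagawaProduct) (v : HeightOneSpectrum (𝓞 ℚ)) (h2v : ((2 : ℕ) : 𝓞 ℚ) ∉ v.asIdeal)
    (hNv : ((W.conductorNorm ℤ : ℕ) : 𝓞 ℚ) ∈ v.asIdeal) (hmult : W.HasMultiplicativeReductionAt v)
    (hρ : ∀ n : ℕ, 0 < n → W.HasSurjectiveModNGaloisRep ((2 : ℤ) ^ n))
    (K : Type) [Field K] [NumberField K] (hK : IsImaginaryQuadratic K) (hodd : Odd (NumberField.discr K))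
    (h3 : NumberField.discr K ≠ -3) (hH : SatisfiesHeegnerHypothesis (W.conductorNorm ℤ) K)
    (Dt : ModularParametrizationData W (W.conductorNorm ℤ)) (hc : Odd Dt.c) (β : ℤ) (ι : K →+* ℂ) (d₁ : KolyvaginHeegnerData Dt β ι 1)
    (hy : ¬ IsOfFinAddOrder d₁.derivedPoint) (M₀ : ℕ)
    (hdiv : ∃ Q : (W.baseChange (ringClassField K ι 1)).toAffine.Point, ((2 ^ M₀ : ℕ) : ℤ) • Q = d₁.derivedPoint)
    (hndiv : ¬ ∃ Q : (W.baseChange (ringClassField K ι 1)).toAffine.Point, ((2 ^ (M₀ + 1) : ℕ) : ℤ) • Q = d₁.derivedPoint)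
    (Wd : WeierstrassCurve ℚ) [Wd.IsElliptic] [Wd.IsGloballyMinimal]
    (hWd : ∃ C : VariableChange ℚ, C • W.quadraticTwist (NumberField.discr K : ℚ) = Wd)
    (hbudget : (W.Δ < 0 ∧ padicValNat 2 Wd.tamagawaProduct ≤ 1) ∨ padicValNat 2 Wd.tamagawaProduct = 0)
    (hdeepTw : M₀ = 0 ∨ ∃ (_ : (W.quadraticTwist ((NumberField.discr K : ℤ) : ℚ)).IsElliptic) (M : ℕ)
      (s₀ : galH1Torsion (W.quadraticTwist ((NumberField.discr K : ℤ) : ℚ)) ((2 ^ M : ℕ) : ℤ)),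
      M₀ + 1 ≤ M ∧ s₀ ∈ selmerGroup (W.quadraticTwist ((NumberField.discr K : ℤ) : ℚ)) ((2 ^ M : ℕ) : ℤ) ∧ ((2 ^ (M₀ - 1) : ℕ) : ℤ) • s₀ ≠ 0) :
    BSDp W 2 := by
  obtain ⟨Cd, hCd⟩ := hWd
  -- the twin model is non-CM (same `j`) of analytic rank `0` (Gross–Zagier), so `BSD₂(Wd)` by S1′
  have hD0 : (NumberField.discr K : ℚ) ≠ 0 := by exact_mod_cast NumberField.discr_ne_zero K
  haveI hTell : (W.quadraticTwist (NumberField.discr K : ℚ)).IsElliptic := W.isElliptic_quadraticTwist hD0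
  obtain ⟨Ph, hPh, hPhmap⟩ := AdditiveKoly.exists_isHeegnerPoint_map_eq_derivedPoint_one (W := W) (K := K) (Dt := Dt) (β := β)
    (ι := ι) hK hH d₁
  have hPinf : ¬ IsOfFinAddOrder Ph := by
    intro hfin
    apply hy
    rw [← hPhmap]
    exact (WeierstrassCurve.Affine.Point.map (W' := W) (algebraMap K (ringClassField K ι 1)).toRatAlgHom).isOfFinAddOrder hfin
  have hrT : (W.quadraticTwist (NumberField.discr K : ℚ)).analyticRank = 0 :=
    analyticRank_twist_eq_zero_of_rankOne W K (hGZ _ W K) hmod hK hH hr hPh hPinf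
  subst hCd
  have hcmd : ¬ (Cd • W.quadraticTwist (NumberField.discr K : ℚ)).HasCM := by
    rw [hasCM_iff_of_j_eq (((W.quadraticTwist (NumberField.discr K : ℚ)).variableChange_j Cd).trans (W.j_quadraticTwist hD0))]
    exact hcm
  have hrd : (Cd • W.quadraticTwist (NumberField.discr K : ℚ)).analyticRank = 0 := by
    rw [analyticRank_smul]
    exact hrT
  have hBSDd : BSDp (Cd • W.quadraticTwist (NumberField.discr K : ℚ)) 2 := hS1 _ hcmd hrd
  rcases hdeepTw with h0 | ⟨iT, M, s₀, hM₀M, hs₀, hne⟩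
  · -- depth 0: the frame itself is the witness (p812083)
    subst h0
    have hndiv' : ¬ ∃ Q : (W.baseChange (ringClassField K ι 1)).toAffine.Point, (2 : ℤ) • Q = d₁.derivedPoint := by
      simpa using hndiv
    exact bsdp_onOddCut_of_depthZeroFrame_of_facts hQ2 hGZ hGZK hmod hMilneC W hcm hr hSel hT v h2v hNv hmult hρ K hK hodd h3 hH Dt hc β ι d₁ hy
      hndiv' (Cd • W.quadraticTwist (NumberField.discr K : ℚ)) ⟨Cd, rfl⟩ hbudget hBSDd
  · -- depth ≥ 1: the halving descent manufactures the witness (p815975 §1)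
    exact bsdp_onOddCut_of_selmer_twist_class_of_facts hQ2 hGZ hGZK hmod hMilneC W hcm hr hSel hT v h2v hNv hmult hρ K hK hodd h3 hH Dt hc β ι d₁
      hy M₀ hdiv hndiv (Cd • W.quadraticTwist (NumberField.discr K : ℚ)) ⟨Cd, rfl⟩ hbudget hBSDd M hM₀M s₀ hs₀ hne

/-! ## §2 U₂ on the cut with `4 ∤ N_W` from WALL row 1 + PRINT + AU + Čes + Q2 + the odd-`c`-free frame supply FRAME♭⁰ -/

/-- **U₂ ON THE ODD HABITAT CUT WITH `4 ∤ N_W` ⟸ WALL row 1 + PRINT + Abbes–Ullmo + Česnavičius + Q2 + FRAME♭⁰** — the Manin clause has LEFT the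
research leaf.  FRAME♭⁰ (`hSupply0`): for every `W` on the cut (non-CM, `r_an = 1`, `#Sel₂ = 2`, `C(W)` odd, `ρ_{W,2^∞}` onto, an odd multiplicative
prime) with `4 ∤ N_W` and EVERY datum `Dt` with odd `c`: ONE odd Heegner frame `K ≠ ℚ(√−3)`, a conductor-`1` datum ON `Dt` with `P(1)` of infinite
order and exact depth `M₀`, a globally minimal twin model in the genus budget, and `M₀ = 0 ∨` a class of `Sel_(2^M)(W^{(d_K)}/ℚ)` (`M ≥ M₀+1`) not
killed by `2^{M₀−1}`.  The odd datum the supply is applied to EXISTS (`OddManin.exists_datum_odd_c_conductor_of_forall_hasSurjectiveModNGaloisRep_of_not_four_dvd`,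
mod AU + Čes + modularity); then §1.  FRAME♭⁰ is OPEN; CONDITIONAL; closes nothing; BSD is NOT proved.
[cite: AbbesUllmo1996, Thm. A] [cite: Cesnavicius2018, Thm. 1.2] [cite: Kolyvagin1989Izv, Thm. A, Thm. B_l] [cite: GrossZagier1986, V.§2 (2.2)] -/
theorem minimalTwinBSDTwo_onOddCut_notFourDvd_of_wall_of_oddFreeFrameSupply_of_facts (hQ2 : KolyvaginRelationAtTwo)
    (hGZ : ∀ (N : ℕ) [NeZero N] (W : WeierstrassCurve ℚ) (K : Type) [Field K] [NumberField K], gross_zagier N W K)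
    (hGZK : rank_eq_analyticRank_of_analyticRank_le_one) (hmod : hasEntireLFunction_rat)
    (hMilneC : Milne1972.bsdQuotient_baseChange_quadratic_anyModel) (hmodD : nonempty_modularParametrizationData)
    (hAU : abbesUllmo_not_dvd_maninConstant_of_not_dvd_level) (hCes : cesnavicius_not_two_dvd_maninConstant_of_two_dvd_level)
    (hS1 : ∀ (W : WeierstrassCurve ℚ) [W.IsElliptic] [W.IsGloballyMinimal], ¬ W.HasCM → W.analyticRank = 0 → BSDp W 2)
    (hSupply0 : ∀ (W : WeierstrassCurve ℚ) [W.IsElliptic] [W.IsGloballyMinimal] [NeZero (W.conductorNorm ℤ)],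
      ¬ W.HasCM → W.analyticRank = 1 → Nat.card (W.selmerGroup 2) = 2 → Odd W.tamagawaProduct →
      (∀ n : ℕ, 0 < n → W.HasSurjectiveModNGaloisRep ((2 : ℤ) ^ n)) →
      (∃ v : HeightOneSpectrum (𝓞 ℚ), ((2 : ℕ) : 𝓞 ℚ) ∉ v.asIdeal ∧ ((W.conductorNorm ℤ : ℕ) : 𝓞 ℚ) ∈ v.asIdeal ∧ W.HasMultiplicativeReductionAt v) →
      ¬ 4 ∣ W.conductorNorm ℤ →
      ∀ (Dt : ModularParametrizationData W (W.conductorNorm ℤ)), Odd Dt.c →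
      ∃ (K : Type) (_ : Field K) (_ : NumberField K), IsImaginaryQuadratic K ∧ Odd (NumberField.discr K) ∧ NumberField.discr K ≠ -3 ∧
        SatisfiesHeegnerHypothesis (W.conductorNorm ℤ) K ∧
        ∃ (β : ℤ) (ι : K →+* ℂ) (d₁ : KolyvaginHeegnerData Dt β ι 1) (M₀ : ℕ),
          ¬ IsOfFinAddOrder d₁.derivedPoint ∧
          (∃ Q : (W.baseChange (ringClassField K ι 1)).toAffine.Point, ((2 ^ M₀ : ℕ) : ℤ) • Q = d₁.derivedPoint) ∧
          (¬ ∃ Q : (W.baseChange (ringClassField K ι 1)).toAffine.Point, ((2 ^ (M₀ + 1) : ℕ) : ℤ) • Q = d₁.derivedPoint) ∧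
          (∃ (Wd : WeierstrassCurve ℚ) (_ : Wd.IsElliptic) (_ : Wd.IsGloballyMinimal),
            (∃ C : VariableChange ℚ, C • W.quadraticTwist (NumberField.discr K : ℚ) = Wd) ∧
              ((W.Δ < 0 ∧ padicValNat 2 Wd.tamagawaProduct ≤ 1) ∨ padicValNat 2 Wd.tamagawaProduct = 0)) ∧
          (M₀ = 0 ∨ ∃ (_ : (W.quadraticTwist ((NumberField.discr K : ℤ) : ℚ)).IsElliptic) (M : ℕ)
            (s₀ : galH1Torsion (W.quadraticTwist ((NumberField.discr K : ℤ) : ℚ)) ((2 ^ M : ℕ) : ℤ)),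
            M₀ + 1 ≤ M ∧ s₀ ∈ selmerGroup (W.quadraticTwist ((NumberField.discr K : ℤ) : ℚ)) ((2 ^ M : ℕ) : ℤ) ∧ ((2 ^ (M₀ - 1) : ℕ) : ℤ) • s₀ ≠ 0)) :
    ∀ (W : WeierstrassCurve ℚ) [W.IsElliptic] [W.IsGloballyMinimal] [NeZero (W.conductorNorm ℤ)],
      ¬ W.HasCM → W.analyticRank = 1 → Nat.card (W.selmerGroup 2) = 2 → Odd W.tamagawaProduct →
      (∀ n : ℕ, 0 < n → W.HasSurjectiveModNGaloisRep ((2 : ℤ) ^ n)) →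
      (∃ v : HeightOneSpectrum (𝓞 ℚ), ((2 : ℕ) : 𝓞 ℚ) ∉ v.asIdeal ∧ ((W.conductorNorm ℤ : ℕ) : 𝓞 ℚ) ∈ v.asIdeal ∧ W.HasMultiplicativeReductionAt v) →
      ¬ 4 ∣ W.conductorNorm ℤ → BSDp W 2 := by
  intro W _ _ _ hcm hr hSel hT hρ hv h4
  -- the odd datum exists (AU + Čes + modularity; `E[2]` irreducible from `ρ̄_{W,2}` onto)
  obtain ⟨Dt, hc⟩ := OddManin.exists_datum_odd_c_conductor_of_forall_hasSurjectiveModNGaloisRep_of_not_four_dvd hAU hCes hmodD W hρ h4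
  obtain ⟨K, iF, iN, hK, hodd, h3, hH, β, ι, d₁, M₀, hy, hdiv, hndiv, ⟨Wd, iE, iM, hWd, hbudget⟩, hdeepTw⟩ :=
    hSupply0 W hcm hr hSel hT hρ hv h4 Dt hc
  obtain ⟨v, h2v, hNv, hmult⟩ := hv
  exact bsdp_onOddCut_of_deepTwinClassFrame_of_facts hQ2 hGZ hGZK hmod hMilneC hS1 W hcm hr hSel hT v h2v hNv hmult hρ K hK hodd h3 hH Dt hc β ι d₁
    hy M₀ hdiv hndiv Wd hWd hbudget hdeepTw

/-! ## §3 The whole cut: FRAME♭⁰ on `4 ∤ N_W`, FRAME♭ on `4 ∣ N_W` -/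

/-- **U₂ ON THE WHOLE ODD HABITAT CUT ⟸ WALL row 1 + PRINT + AU + Čes + Q2 + FRAME♭⁰|_{4 ∤ N} + FRAME♭|_{4 ∣ N}.**  The split frame supply: on
`4 ∤ N_W` the odd-`c`-free form of §2 (`hSupply0`); on `4 ∣ N_W` (additive reduction at `2` with `v₂(N) ≥ 2`, where the parity of the Manin constant of
the strong Weil curve is open in print) the old FRAME♭ with its «`∃ Dt`, `Odd Dt.c`» conjunct (`hSupply4`, = p815975's `hSupplyD` restricted).
CONDITIONAL; both supplies OPEN; closes nothing; BSD is NOT proved. [cite: AbbesUllmo1996, Thm. A] [cite: Cesnavicius2018, Thm. 1.2]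
[cite: Kolyvagin1989Izv, Thm. A, Thm. B_l] [cite: GrossZagier1986, V.§2 (2.2)] -/
theorem minimalTwinBSDTwo_onOddCut_of_wall_of_splitFrameSupply_of_facts (hQ2 : KolyvaginRelationAtTwo)
    (hGZ : ∀ (N : ℕ) [NeZero N] (W : WeierstrassCurve ℚ) (K : Type) [Field K] [NumberField K], gross_zagier N W K)
    (hGZK : rank_eq_analyticRank_of_analyticRank_le_one) (hmod : hasEntireLFunction_rat)
    (hMilneC : Milne1972.bsdQuotient_baseChange_quadratic_anyModel) (hmodD : nonempty_modularParametrizationData)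
    (hAU : abbesUllmo_not_dvd_maninConstant_of_not_dvd_level) (hCes : cesnavicius_not_two_dvd_maninConstant_of_two_dvd_level)
    (hS1 : ∀ (W : WeierstrassCurve ℚ) [W.IsElliptic] [W.IsGloballyMinimal], ¬ W.HasCM → W.analyticRank = 0 → BSDp W 2)
    (hSupply0 : ∀ (W : WeierstrassCurve ℚ) [W.IsElliptic] [W.IsGloballyMinimal] [NeZero (W.conductorNorm ℤ)],
      ¬ W.HasCM → W.analyticRank = 1 → Nat.card (W.selmerGroup 2) = 2 → Odd W.tamagawaProduct →
      (∀ n : ℕ, 0 < n → W.HasSurjectiveModNGaloisRep ((2 : ℤ) ^ n)) →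
      (∃ v : HeightOneSpectrum (𝓞 ℚ), ((2 : ℕ) : 𝓞 ℚ) ∉ v.asIdeal ∧ ((W.conductorNorm ℤ : ℕ) : 𝓞 ℚ) ∈ v.asIdeal ∧ W.HasMultiplicativeReductionAt v) →
      ¬ 4 ∣ W.conductorNorm ℤ →
      ∀ (Dt : ModularParametrizationData W (W.conductorNorm ℤ)), Odd Dt.c →
      ∃ (K : Type) (_ : Field K) (_ : NumberField K), IsImaginaryQuadratic K ∧ Odd (NumberField.discr K) ∧ NumberField.discr K ≠ -3 ∧
        SatisfiesHeegnerHypothesis (W.conductorNorm ℤ) K ∧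
        ∃ (β : ℤ) (ι : K →+* ℂ) (d₁ : KolyvaginHeegnerData Dt β ι 1) (M₀ : ℕ),
          ¬ IsOfFinAddOrder d₁.derivedPoint ∧
          (∃ Q : (W.baseChange (ringClassField K ι 1)).toAffine.Point, ((2 ^ M₀ : ℕ) : ℤ) • Q = d₁.derivedPoint) ∧
          (¬ ∃ Q : (W.baseChange (ringClassField K ι 1)).toAffine.Point, ((2 ^ (M₀ + 1) : ℕ) : ℤ) • Q = d₁.derivedPoint) ∧
          (∃ (Wd : WeierstrassCurve ℚ) (_ : Wd.IsElliptic) (_ : Wd.IsGloballyMinimal),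
            (∃ C : VariableChange ℚ, C • W.quadraticTwist (NumberField.discr K : ℚ) = Wd) ∧
              ((W.Δ < 0 ∧ padicValNat 2 Wd.tamagawaProduct ≤ 1) ∨ padicValNat 2 Wd.tamagawaProduct = 0)) ∧
          (M₀ = 0 ∨ ∃ (_ : (W.quadraticTwist ((NumberField.discr K : ℤ) : ℚ)).IsElliptic) (M : ℕ)
            (s₀ : galH1Torsion (W.quadraticTwist ((NumberField.discr K : ℤ) : ℚ)) ((2 ^ M : ℕ) : ℤ)),
            M₀ + 1 ≤ M ∧ s₀ ∈ selmerGroup (W.quadraticTwist ((NumberField.discr K : ℤ) : ℚ)) ((2 ^ M : ℕ) : ℤ) ∧ ((2 ^ (M₀ - 1) : ℕ) : ℤ) • s₀ ≠ 0))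
    (hSupply4 : ∀ (W : WeierstrassCurve ℚ) [W.IsElliptic] [W.IsGloballyMinimal] [NeZero (W.conductorNorm ℤ)],
      ¬ W.HasCM → W.analyticRank = 1 → Nat.card (W.selmerGroup 2) = 2 → Odd W.tamagawaProduct →
      (∀ n : ℕ, 0 < n → W.HasSurjectiveModNGaloisRep ((2 : ℤ) ^ n)) →
      (∃ v : HeightOneSpectrum (𝓞 ℚ), ((2 : ℕ) : 𝓞 ℚ) ∉ v.asIdeal ∧ ((W.conductorNorm ℤ : ℕ) : 𝓞 ℚ) ∈ v.asIdeal ∧ W.HasMultiplicativeReductionAt v) →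
      4 ∣ W.conductorNorm ℤ →
      ∃ (K : Type) (_ : Field K) (_ : NumberField K), IsImaginaryQuadratic K ∧ Odd (NumberField.discr K) ∧ NumberField.discr K ≠ -3 ∧
        SatisfiesHeegnerHypothesis (W.conductorNorm ℤ) K ∧
        ∃ (Dt : ModularParametrizationData W (W.conductorNorm ℤ)) (β : ℤ) (ι : K →+* ℂ) (d₁ : KolyvaginHeegnerData Dt β ι 1) (M₀ : ℕ),
          Odd Dt.c ∧ ¬ IsOfFinAddOrder d₁.derivedPoint ∧
          (∃ Q : (W.baseChange (ringClassField K ι 1)).toAffine.Point, ((2 ^ M₀ : ℕ) : ℤ) • Q = d₁.derivedPoint) ∧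
          (¬ ∃ Q : (W.baseChange (ringClassField K ι 1)).toAffine.Point, ((2 ^ (M₀ + 1) : ℕ) : ℤ) • Q = d₁.derivedPoint) ∧
          (∃ (Wd : WeierstrassCurve ℚ) (_ : Wd.IsElliptic) (_ : Wd.IsGloballyMinimal),
            (∃ C : VariableChange ℚ, C • W.quadraticTwist (NumberField.discr K : ℚ) = Wd) ∧
              ((W.Δ < 0 ∧ padicValNat 2 Wd.tamagawaProduct ≤ 1) ∨ padicValNat 2 Wd.tamagawaProduct = 0)) ∧
          (M₀ = 0 ∨ ∃ (_ : (W.quadraticTwist ((NumberField.discr K : ℤ) : ℚ)).IsElliptic) (M : ℕ)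
            (s₀ : galH1Torsion (W.quadraticTwist ((NumberField.discr K : ℤ) : ℚ)) ((2 ^ M : ℕ) : ℤ)),
            M₀ + 1 ≤ M ∧ s₀ ∈ selmerGroup (W.quadraticTwist ((NumberField.discr K : ℤ) : ℚ)) ((2 ^ M : ℕ) : ℤ) ∧ ((2 ^ (M₀ - 1) : ℕ) : ℤ) • s₀ ≠ 0)) :
    ∀ (W : WeierstrassCurve ℚ) [W.IsElliptic] [W.IsGloballyMinimal] [NeZero (W.conductorNorm ℤ)],
      ¬ W.HasCM → W.analyticRank = 1 → Nat.card (W.selmerGroup 2) = 2 → Odd W.tamagawaProduct →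
      (∀ n : ℕ, 0 < n → W.HasSurjectiveModNGaloisRep ((2 : ℤ) ^ n)) →
      (∃ v : HeightOneSpectrum (𝓞 ℚ), ((2 : ℕ) : 𝓞 ℚ) ∉ v.asIdeal ∧ ((W.conductorNorm ℤ : ℕ) : 𝓞 ℚ) ∈ v.asIdeal ∧ W.HasMultiplicativeReductionAt v) →
      BSDp W 2 := by
  intro W _ _ _ hcm hr hSel hT hρ hv
  by_cases h4 : 4 ∣ W.conductorNorm ℤ
  · obtain ⟨K, iF, iN, hK, hodd, h3, hH, Dt, β, ι, d₁, M₀, hc, hy, hdiv, hndiv, ⟨Wd, iE, iM, hWd, hbudget⟩, hdeepTw⟩ :=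
      hSupply4 W hcm hr hSel hT hρ hv h4
    obtain ⟨v, h2v, hNv, hmult⟩ := hv
    exact bsdp_onOddCut_of_deepTwinClassFrame_of_facts hQ2 hGZ hGZK hmod hMilneC hS1 W hcm hr hSel hT v h2v hNv hmult hρ K hK hodd h3 hH Dt hc β ι
      d₁ hy M₀ hdiv hndiv Wd hWd hbudget hdeepTw
  · exact minimalTwinBSDTwo_onOddCut_notFourDvd_of_wall_of_oddFreeFrameSupply_of_facts hQ2 hGZ hGZK hmod hMilneC hmodD hAU hCes hS1 hSupply0 W
      hcm hr hSel hT hρ hv h4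

end Summit.BirchSwinnertonDyer.BirchSwinnertonDyer.Theorems.GenusExact.TwinSwap.TwinAnnihilation

end
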